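import Literature.AlgebraicGeometry.ShimuraVarieties.UnitaryShimuraCurveGSAdaptedFrame
import Summits.HodgeConjecture.HodgeCM.Model.ArchKTypeOfFin_1
import HarnessLib

/-!
# The Hodge–CM package's frame transport `finFrameCongr` on `GL_N(𝔸_{L,f})`, and the adapted transport of a split
hermitian 3-space as `finAdelicCongr (D′⁻¹g₀) ∘ finFrameCongr g₀`

* §1 **`HodgeCM.Model.coe_finFrameCongr`**: the package's frame transport `finFrameCongr L H g d hg`
  (`finPart ∘ cmKTypeHom ∘ finAdelicToAdelic`, the pin's `ιVE V` of `HodgeCM/Model/LiuDictionaryPin.lean`) IS plain conjugation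
  `k ↦ g_f⁻¹ · k · g_f` on `GL_N(𝔸_{L,f})`; with `sndHom_toAdeleGL` (the finite part of the diagonal embedding
  `GL_N(L) → GL_N(𝔸_L)` is the diagonal embedding `GL_N(L) → GL_N(𝔸_{L,f})`).
* §2 **`gsAdaptedTransport_eq_finAdelicCongr_finFrameCongr`**: for a split hermitian 3-space (frame `B`, curve frame `g⋆`,
  adapted frame `D′ = B·(g⋆ ⊕ 1)`, `Literature/AlgebraicGeometry/ShimuraVarieties/UnitaryShimuraCurveGSAdaptedFrame.lean`) and any
  other frame `g₀` of `H`, the adapted transport `ι_{D′} : U(H)(𝔸_f) → U(diag dV)(𝔸_f)` is the model frame transport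
  `finFrameCongr L H g₀ d₀ hg₀` followed by `finAdelicCongr (gsFrameComparison …) one_ne_zero _` — the point at which a frame-transport
  statement for Weil-type representations stated at `g₀` is moved to the adapted frame.

Transport of unitary groups along a change of frame: [PlatonovRapinchuk1994, §2.3, §5.1]; the split `V = V⋆ ⊕ V⋆^⊥`:
[Liu2021, proof of Thm. 4.15 (FJcycle.tex l. 2193–2203), Def. 4.11 (l. 2092–2096)].
-/

set_option autoImplicit false

noncomputable section

open scoped Matrix
open NumberField Matrix IsDedekindDomain
open Literature.NumberTheory.Automorphic Literature.NumberTheory.Automorphic.UnitaryGroup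

/-! ## §1 The package's frame transport `finFrameCongr` on `GL_N(𝔸_{L,f})` -/

namespace HodgeCM.Model

section FinFrameCongr

variable (L : Type) [Field L] [NumberField L] [IsCMField L] {N : ℕ} (H : Matrix (Fin N) (Fin N) L)
  (g : GL (Fin N) L) (d : Fin N → L)
  (hg : ((g : Matrix (Fin N) (Fin N) L).map (cmConjRingHom L))ᵀ * H * (g : Matrix (Fin N) (Fin N) L) = Matrix.diagonal d)

omit [IsCMField L] in
/-- the finite part of the diagonal embedding `GL_N(L) → GL_N(𝔸_L)` is the diagonal embedding `GL_N(L) → GL_N(𝔸_{L,f})`.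
[cite: PlatonovRapinchuk1994, §5.1] -/
theorem sndHom_toAdeleGL (γ : GL (Fin N) L) : GLn.sndHom N L (toAdeleGL L γ) = toFinAdeleGL L N γ :=
  Matrix.GeneralLinearGroup.ext fun _ _ => rfl

/-- **`finFrameCongr L H g d hg k = g_f⁻¹ · k · g_f` in `GL_N(𝔸_{L,f})`**: the adelic detour
`finPart ∘ cmKTypeHom ∘ finAdelicToAdelic` of `finFrameCongr` (the pin's `ιVE V`) is plain conjugation by the finite-adelic
image of the frame. [cite: PlatonovRapinchuk1994, §2.3, §5.1] -/
theorem coe_finFrameCongr (k : UnitaryGroup.finAdelic (↥(maximalRealSubfield L)) L (IsCMField.complexConj L) N H) :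
    ((finFrameCongr L H g d hg k :
        UnitaryGroup.finAdelic (↥(maximalRealSubfield L)) L (IsCMField.complexConj L) N (Matrix.diagonal d)) :
          GL (Fin N) (FiniteAdeleRing (𝓞 L) L)) =
      (toFinAdeleGL L N g)⁻¹ * k * toFinAdeleGL L N g := by
  rw [finFrameCongr_apply, coe_finPart]
  have hval : adelicVal (↥(maximalRealSubfield L)) L (IsCMField.complexConj L) N (Matrix.diagonal d)
      (Literature.NumberTheory.GelbartRogawski1991.UnitaryDualPair.cmKTypeHom L H g d hg
        (finAdelicToAdelic (↥(maximalRealSubfield L)) L (IsCMField.complexConj L) N H k)) =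
      (toAdeleGL L g)⁻¹ * GLn.ofFinite N L k * toAdeleGL L g :=
    Literature.NumberTheory.GelbartRogawski1991.UnitaryDualPair.coe_cmKTypeHom L H g d hg _
  rw [hval, map_mul, map_mul, map_inv, GLn.sndHom_ofFinite, sndHom_toAdeleGL]

end FinFrameCongr

end HodgeCM.Model

/-! ## §2 The adapted transport is `finAdelicCongr (D′⁻¹g₀) ∘ finFrameCongr g₀` -/

namespace Literature.AlgebraicGeometry.ShimuraVarieties.UnitaryCanonicalModel

section Comparison

variable (L : Type) [Field L] [NumberField L] [IsCMField L] (Jstar : Matrix (Fin 2) (Fin 2) L)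
  (Jperp : Matrix (Fin 1) (Fin 1) L) (H : Matrix (Fin 3) (Fin 3) L) (B : GL (Fin 3) L) {a : L} (ha : a ≠ 0)
  (hB : formCongr ((IsCMField.complexConj L : L ≃ₐ[↥(maximalRealSubfield L)] L) : L →+* L) B (a • H) =
    finSum 2 1 Jstar Jperp)
  (gstar : GL (Fin 2) L) (dJ : Fin 2 → L)
  (hg : formCongr ((IsCMField.complexConj L : L ≃ₐ[↥(maximalRealSubfield L)] L) : L →+* L) gstar (a⁻¹ • Jstar) =
    Matrix.diagonal dJ)
  (g₀ : GL (Fin 3) L) (d₀ : Fin 3 → L)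
  (hg₀ : ((g₀ : Matrix (Fin 3) (Fin 3) L).map (cmConjRingHom L))ᵀ * H * (g₀ : Matrix (Fin 3) (Fin 3) L) = Matrix.diagonal d₀)

/-- **`ι_{D′} = Ad(D′⁻¹g₀) ∘ ι_{g₀}`**: the adapted transport IS the model frame transport `HodgeCM.Model.finFrameCongr L H g₀ d₀ hg₀`
followed by the conjugation `UnitaryGroup.finAdelicCongr (gsFrameComparison …) one_ne_zero _` — so a frame-transport statement at
`(dV := d₀, dV′ := dJ ‖ a⁻¹J⊥₀₀, B := D′⁻¹g₀)` moves the face model at `g₀` to the adapted face model.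
[cite: PlatonovRapinchuk1994, §2.3, §5.1] [cite: Liu2021, Def. 4.11 (l. 2092–2096)] -/
theorem gsAdaptedTransport_eq_finAdelicCongr_finFrameCongr
    (k : ↥(finAdelic (↥(maximalRealSubfield L)) L (IsCMField.complexConj L) 3 H)) :
    gsAdaptedTransport L Jstar Jperp H B ha hB gstar dJ hg k =
      finAdelicCongr (↥(maximalRealSubfield L)) L (IsCMField.complexConj L) (gsFrameComparison L B gstar g₀) one_ne_zero
        (formCongr_gsFrameComparison L Jstar Jperp H B ha hB gstar dJ hg g₀ d₀ hg₀)
        (HodgeCM.Model.finFrameCongr L H g₀ d₀ hg₀ k) := by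
  apply Subtype.ext
  rw [coe_gsAdaptedTransport, coe_finAdelicCongr_apply, HodgeCM.Model.coe_finFrameCongr, gsFrameComparison, map_mul, map_inv]
  group

end Comparison

end Literature.AlgebraicGeometry.ShimuraVarieties.UnitaryCanonicalModel

end
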